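import Literature.Computability.Complexity.GraphCanonizationProgramRefine
import Literature.Computability.Complexity.CodeFPClosure
import HarnessLib

/-!
# The canoniser as a list program, III: components and parts of a state on lists

The section step of the canoniser (`GraphCanonizationScheme.lean`: the components `CGCanon.comp`
of the switched graph `CGCanon.swG`, the parts `CGCanon.parts`, connectivity `CGCanon.IsConn`) as a
list program, through the tree's least-label connected-components routine `MinLabel.minLabels`
(`CodeFPClosure.lean`, already typed polynomial time there):

* `swEdgesL` — the edge list of the switched graph of the state; `labelsL` — the least label of
  every vertex's class; **`labelsL_eq_iff`** — two vertices get the same label iff they are joined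
  in `swG G W c` (the equivalence generated by the edge list is reachability);
* `compMaskL` = `maskOf (comp G W c u)` (`compMaskL_eq`), `isConnL` = `IsConn` (`isConnL_eq`),
  `partsL` — a duplicate-free list of the masks of the parts (`nodup_partsL`, `mem_partsL_iff`).

## References

* B. Laubner, PhD thesis, HU Berlin 2011, doi:10.18452/16335, Prop. 3.3.4, §3.4 step 2. [Laubner2011]
* S. Arora, B. Barak, *Computational Complexity: A Modern Approach*, CUP 2009, §1.3. [AroraBarakCC2009]
-/

namespace Literature.Computability.Complexity

open Literature.Combinatorics.SimpleGraph Finset ColourRefinementScheme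

open scoped Classical

noncomputable section

namespace CGProg

variable {k : ℕ}

/-! ### Labels of the components of the switched graph -/

/-- The edge list of the switched graph of the state `(mask, col)` (colours NOT yet lifted). [cite: Laubner2011, Def. 3.3.2] -/
def swEdgesL (n : ℕ) (A : List (List Bool)) (mask : List Bool) (col : List ℕ) : List (ℕ × ℕ) :=
  ((List.range n).product (List.range n)).filter fun p => swAdjL n A mask (liftL mask col) p.1 p.2

/-- The least label of the class of every vertex. [cite: AroraBarakCC2009, §1.3] -/
def labelsL (n : ℕ) (A : List (List Bool)) (mask : List Bool) (col : List ℕ) : List ℕ :=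
  MinLabel.minLabels (swEdgesL n A mask col) n

variable (G : SimpleGraph (Fin k)) (W : Finset (Fin k)) (c : Fin k → ℕ)

/-- Membership in the edge list. [folklore] -/
theorem mem_swEdgesL_iff (a b : ℕ) : (a, b) ∈ swEdgesL k (adjOf G) (maskOf W) (colOf c) ↔
    ∃ (ha : a < k) (hb : b < k), (CGCanon.swG G W c).Adj ⟨a, ha⟩ ⟨b, hb⟩ := by
  unfold swEdgesL
  rw [List.mem_filter, List.pair_mem_product, List.mem_range, List.mem_range]
  constructor
  · rintro ⟨⟨ha, hb⟩, h⟩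
    refine ⟨ha, hb, ?_⟩
    have := swAdjL_liftL G W c ⟨a, ha⟩ ⟨b, hb⟩
    rw [h] at this
    exact of_decide_eq_true this.symm
  · rintro ⟨ha, hb, h⟩
    refine ⟨⟨ha, hb⟩, ?_⟩
    have := swAdjL_liftL G W c ⟨a, ha⟩ ⟨b, hb⟩
    rw [decide_eq_true h] at this
    exact this

/-- The edges lie below `k`. [folklore] -/
theorem swEdgesL_lt : ∀ e ∈ swEdgesL k (adjOf G) (maskOf W) (colOf c), e.1 < k ∧ e.2 < k := by
  rintro ⟨a, b⟩ h
  obtain ⟨ha, hb, -⟩ := (mem_swEdgesL_iff G W c a b).1 h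
  exact ⟨ha, hb⟩

/-- The equivalence generated by the edge list is reachability in the switched graph. [folklore] -/
theorem eqvGen_iff_reachable (u v : Fin k) :
    Relation.EqvGen (MinLabel.Adj (swEdgesL k (adjOf G) (maskOf W) (colOf c))) u.val v.val ↔ (CGCanon.swG G W c).Reachable u v := by
  constructor
  · suffices H : ∀ x y : ℕ, Relation.EqvGen (MinLabel.Adj (swEdgesL k (adjOf G) (maskOf W) (colOf c))) x y →
        x = y ∨ ∃ (hx : x < k) (hy : y < k), (CGCanon.swG G W c).Reachable ⟨x, hx⟩ ⟨y, hy⟩ by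
      intro h
      rcases H _ _ h with h | ⟨hx, hy, h⟩
      · rw [Fin.ext h]
      · exact h
    intro x y h
    induction h with
    | rel a b hab =>
      obtain ⟨ha, hb, h⟩ := (mem_swEdgesL_iff G W c a b).1 hab
      exact Or.inr ⟨ha, hb, h.reachable⟩
    | refl a => exact Or.inl rfl
    | symm a b _ ih =>
      rcases ih with rfl | ⟨ha, hb, h⟩
      · exact Or.inl rfl
      · exact Or.inr ⟨hb, ha, h.symm⟩
    | trans a b d _ _ ih₁ ih₂ =>
      rcases ih₁ with rfl | ⟨ha, hb, h₁⟩
      · exact ih₂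
      · rcases ih₂ with rfl | ⟨hb', hd, h₂⟩
        · exact Or.inr ⟨ha, hb, h₁⟩
        · exact Or.inr ⟨ha, hd, h₁.trans h₂⟩
  · rintro ⟨p⟩
    induction p with
    | nil => exact Relation.EqvGen.refl _
    | cons h _ ih => exact (Relation.EqvGen.rel _ _ ((mem_swEdgesL_iff G W c _ _).2 ⟨_, _, h⟩)).trans _ _ _ ih

/-- **Equal labels iff joined in the switched graph.** [folklore] -/
theorem labelsL_eq_iff (u v : Fin k) :
    natAt (labelsL k (adjOf G) (maskOf W) (colOf c)) u = natAt (labelsL k (adjOf G) (maskOf W) (colOf c)) v ↔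
      (CGCanon.swG G W c).Reachable u v := by
  unfold natAt labelsL
  rw [MinLabel.getD_minLabels _ (swEdgesL_lt G W c) u.isLt, MinLabel.getD_minLabels _ (swEdgesL_lt G W c) v.isLt,
    ← eqvGen_iff_reachable]
  constructor
  · intro h
    exact ((MinLabel.eqvGen_classMin _ u.val).symm.trans _ _ _ (h ▸ MinLabel.eqvGen_classMin _ v.val))
  · exact MinLabel.classMin_eq_of_eqvGen _

/-! ### Components, connectivity, parts -/

/-- The mask of the component of `u`. [cite: Laubner2011, Prop. 3.3.4] -/
def compMaskL (n : ℕ) (A : List (List Bool)) (mask : List Bool) (col : List ℕ) (u : ℕ) : List Bool :=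
  (List.range n).map fun v => bitAt mask v && decide (natAt (labelsL n A mask col) v = natAt (labelsL n A mask col) u)

/-- `compMaskL` is the mask of `comp`. [folklore] -/
theorem compMaskL_eq (u : Fin k) : compMaskL k (adjOf G) (maskOf W) (colOf c) u = maskOf (CGCanon.comp G W c u) := by
  unfold compMaskL
  refine map_range_eq_ofFn fun v => ?_
  rw [bitAt_maskOf]
  by_cases hv : v ∈ W
  · by_cases h : (CGCanon.swG G W c).Reachable u v
    · simp [hv, CGCanon.mem_comp, h, (labelsL_eq_iff G W c v u).2 h.symm]
    · have : ¬ natAt (labelsL k (adjOf G) (maskOf W) (colOf c)) v = natAt (labelsL k (adjOf G) (maskOf W) (colOf c)) u :=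
        fun h' => h ((labelsL_eq_iff G W c v u).1 h').symm
      simp [hv, CGCanon.mem_comp, h, this]
  · simp [hv, CGCanon.mem_comp]

/-- Connectivity of the state on lists. [cite: Laubner2011, §3.4] -/
def isConnL (n : ℕ) (A : List (List Bool)) (mask : List Bool) (col : List ℕ) : Bool :=
  (List.range n).all fun u => (List.range n).all fun v =>
    !(bitAt mask u && bitAt mask v) || decide (natAt (labelsL n A mask col) u = natAt (labelsL n A mask col) v)

/-- `isConnL` is `IsConn`. [folklore] -/
theorem isConnL_eq : isConnL k (adjOf G) (maskOf W) (colOf c) = decide (CGCanon.IsConn G W c) := by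
  rw [Bool.eq_iff_iff, decide_eq_true_iff]
  unfold isConnL CGCanon.IsConn
  rw [all_range_iff]
  refine forall_congr' fun u => ?_
  rw [all_range_iff]
  constructor
  · intro h hu v hv
    have := h v
    rw [bitAt_maskOf, bitAt_maskOf, decide_eq_true hu, decide_eq_true hv] at this
    simpa [labelsL_eq_iff] using this
  · intro h v
    rw [bitAt_maskOf, bitAt_maskOf]
    by_cases hu : u ∈ W <;> by_cases hv : v ∈ W <;> simp [hu, hv, labelsL_eq_iff, h]

/-- **The parts of the state on lists**: the distinct component masks of the vertices of the mask. [cite: Laubner2011, §3.4 step 2] -/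
def partsL (n : ℕ) (A : List (List Bool)) (mask : List Bool) (col : List ℕ) : List (List Bool) :=
  ((wlistL mask).map (compMaskL n A mask col)).dedup

/-- `maskOf` is injective. [folklore] -/
theorem maskOf_injective : Function.Injective (maskOf (k := k)) := fun W W' h => by
  ext i
  have := congrArg (fun l => bitAt l i) h
  simpa [bitAt_maskOf] using this

/-- `partsL` has no duplicates. [folklore] -/
theorem nodup_partsL (n : ℕ) (A : List (List Bool)) (mask : List Bool) (col : List ℕ) : (partsL n A mask col).Nodup := List.nodup_dedup _

/-- **The items of `partsL` are exactly the masks of the parts.** [folklore] -/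
theorem mem_partsL_iff (m : List Bool) : m ∈ partsL k (adjOf G) (maskOf W) (colOf c) ↔ ∃ K ∈ CGCanon.parts G W c, m = maskOf K := by
  unfold partsL
  rw [List.mem_dedup, List.mem_map, wlistL_eq]
  simp only [List.mem_map, mem_sort, CGCanon.parts, mem_image]
  constructor
  · rintro ⟨_, ⟨u, hu, rfl⟩, rfl⟩
    exact ⟨_, ⟨u, hu, rfl⟩, (compMaskL_eq G W c u).symm ▸ rfl⟩
  · rintro ⟨_, ⟨u, hu, rfl⟩, rfl⟩
    exact ⟨u.val, ⟨u, hu, rfl⟩, compMaskL_eq G W c u⟩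

/-- Hence `partsL` lists the masks of the parts, each once. [folklore] -/
theorem partsL_perm : (partsL k (adjOf G) (maskOf W) (colOf c)).Perm ((CGCanon.parts G W c).toList.map maskOf) := by
  apply List.perm_of_nodup_nodup_toFinset_eq (nodup_partsL _ _ _ _) ((nodup_toList _).map maskOf_injective)
  ext m
  rw [List.mem_toFinset, List.mem_toFinset, mem_partsL_iff, List.mem_map]
  simp only [mem_toList]
  exact ⟨fun ⟨K, hK, h⟩ => ⟨K, hK, h.symm⟩, fun ⟨K, hK, h⟩ => ⟨K, hK, h.symm⟩⟩

end CGProg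

end

end Literature.Computability.Complexity
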